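import Summits.ResolutionOfSingularities.ResolutionOfSingularities.Theorems.HilbertSamuelEliminationSigmaMaxModificationsCorridor3TameSmallPrimes
import Summits.ResolutionOfSingularities.ResolutionOfSingularities.Theorems.HilbertSamuelEliminationSigmaMaxModificationsLevelRaise
import Literature.AlgebraicGeometry.Resolution.RegularLocusDense
import Literature.AlgebraicGeometry.Resolution.QuasiExcellentSchemes
import Mathlib.AlgebraicGeometry.Morphisms.Proper
import Mathlib.AlgebraicGeometry.Noetherian
import Mathlib.FieldTheory.Perfect
import HarnessLib

/-!
# `SigmaMaxModificationsCorridor3` (stmt-19249), line `tame_wild`: the stub `stub_tameNu3` at `p = 3`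
# REDUCES to the quadric gap (a maximal double-point stratum is isolated)

[OURS · L1 W4.2] For `p = 3` a tame value of `Σ_Y(3)` other than `Φ^{(3)}` is `hypersurfaceHF 2 =: q` (the
Hilbert–Samuel function of a double point, `n ↦ (n+1)²`; `two_le_of_isTameValue_of_mem_hsValues`). The
**quadric gap** says that no Hilbert–Samuel value of a reduced finite-type `k`-scheme of dimension `≤ 3`
lies strictly between the regular value `Φ^{(3)}` and `q`: a NON-REGULAR point `y` with `H^3_Y(y) ≤ q` has
`H^3_Y(y) = q`. (Paper proof, to be formalised on top of the chain's helpers H1′/H1″: `H(1) = φ + emb.dim ≤ 4`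
forces `ψ_Y(y) = dim 𝒪_{Y,y} =: d` and `emb.dim 𝒪_{Y,y} = d + 1`; reduced + all minimal primes of dimension
`d` in a regular local ring of dimension `d + 1`, a UFD (`IsRegularLocalRing.uniqueFactorizationMonoid`),
makes `𝒪_{Y,y} = R/(g)` a hypersurface of some order `m' ≥ 2`; its value is `hypersurfaceHF m'`, and
`hypersurfaceHF m' ≤ q` forces `m' = 2`.) GIVEN the gap (hypothesis `hgap`, stated below in the tree's
vocabulary), this file PROVES:

* `isClosed_compl_regularLocus_diff_hsStratum_of_quadricGap` — `Sing Y ∖ Y(q)` is closed (it is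
  `Sing Y ∩ {y | ¬ H(y) ≤ q}`, and `{H ≤ q}` is open: finitely many values, each `Y(≥ λ)` closed);
* `disjoint_closure_of_quadricGap` — hence `Y(q)` is ISOLATED: `closure (Sing Y ∖ Y(q)) ∩ Y(q) = ∅`;
* `tameNu3_three_of_quadricGap` — the registered `stub_tameNu3` SPECIALISED TO `p = 3` holds (vacuously:
  its non-isolation hypothesis is contradicted), and `tameNu3_of_prime_le_three_of_quadricGap` (`p ≤ 3`).

So, modulo the quadric gap, the tame regime of line `tame_wild` is EMPTY for `p ≤ 3` — the kernel form of
the census line "for `p ∈ {2, 3}` everything is wild" (CJS Rem. 6.29, obstruction O1 at `p = 2`).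
NOT a statement of any manuscript. [cite: CossartJannsenSaito2020, Def. 2.28, Lemma 2.34, Lemma 2.36, Rem. 6.29]
-/

set_option linter.dupNamespace false -- mandated namespace of this single-conjunct summit

noncomputable section

open CategoryTheory AlgebraicGeometry TopologicalSpace Topology
open Literature.AlgebraicGeometry.Resolution Literature.RingTheory.HilbertSamuel
open Summit.ResolutionOfSingularities.ResolutionOfSingularities.Theorems.SigmaMaxModifications.Sketch
open Summit.ResolutionOfSingularities.ResolutionOfSingularities.Theorems.SigmaMaxModifications

namespace Summit.ResolutionOfSingularities.ResolutionOfSingularities.Theorems.SigmaMaxModificationsCorridor3.TameWild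

/-- **The sub-level set `{y | H^N_Y(y) ≤ μ}` is open** when every `Y(≥ λ)` is closed and `Σ_Y(N)` is finite:
its complement is the finite union of the closed `Y(≥ λ)`, `λ` a value with `¬ λ ≤ μ` (CJS Lemma 2.34 (a),
Lemma 2.36; re-derived — the copies in the level-raising files are private).
[cite: CossartJannsenSaito2020, Lemma 2.34, Lemma 2.36] -/
theorem isOpen_setOf_hsFun_le' {Y : Scheme.{0}} {N : ℕ}
    (husc : ∀ ν : ℕ → ℕ, IsClosed (Scheme.hsStratumGE Y N ν))
    (hfin : (Scheme.hsValues Y N).Finite) (μ : ℕ → ℕ) :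
    IsOpen {y : Y | Scheme.hsFun Y N y ≤ μ} := by
  have h : {y : Y | Scheme.hsFun Y N y ≤ μ}ᶜ =
      ⋃ ν ∈ {ν ∈ Scheme.hsValues Y N | ¬ ν ≤ μ}, Scheme.hsStratumGE Y N ν := by
    ext y
    simp only [Set.mem_compl_iff, Set.mem_setOf_eq, Set.mem_iUnion, Scheme.mem_hsStratumGE_iff,
      exists_prop]
    exact ⟨fun hy => ⟨_, ⟨⟨y, rfl⟩, hy⟩, le_rfl⟩,
      fun ⟨ν, ⟨_, hνμ⟩, hνy⟩ hyμ => hνμ (hνy.trans hyμ)⟩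
  rw [← isClosed_compl_iff, h]
  exact (hfin.subset (Set.sep_subset _ _)).isClosed_biUnion fun ν _ => husc ν

/-- **Given the quadric gap, `Sing Y ∖ Y(q)` is closed** (`q = hypersurfaceHF 2`), for `Y` reduced of finite
type over a field with `dim Y ≤ 3`: it equals `Sing Y ∩ {y | ¬ H^3_Y(y) ≤ q}`, the intersection of the closed
non-regular locus (quasi-excellence) with the complement of the open sub-level set `{H ≤ q}`.
[cite: CossartJannsenSaito2020, Lemma 2.34, Lemma 2.36, Rem. 6.29] -/
theorem isClosed_compl_regularLocus_diff_hsStratum_of_quadricGap {k : Type} [Field k] {Y : Scheme.{0}}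
    (g : Y ⟶ Spec (.of k)) [LocallyOfFiniteType g] [QuasiCompact g]
    (hdim : topologicalKrullDim Y ≤ ((3 : ℕ) : WithBot ℕ∞))
    (hgap : ∀ y : Y, y ∉ Scheme.regularLocus Y → Scheme.hsFun Y 3 y ≤ hypersurfaceHF 2 →
      Scheme.hsFun Y 3 y = hypersurfaceHF 2) :
    IsClosed ((Scheme.regularLocus Y)ᶜ \ Scheme.hsStratum Y 3 (hypersurfaceHF 2)) := by
  haveI : IsLocallyNoetherian Y := LocallyOfFiniteType.isLocallyNoetherian g
  haveI : IsNoetherian Y := Scheme.isNoetherian_of_finiteType_over_field g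
  have hexc : Scheme.IsExcellent Y := Scheme.isExcellent_of_locallyOfFiniteType Stacks07QW_field_holds g
  have hψ : ∀ y : Y, Scheme.hsPsi Y y ≤ 3 := Negative.hsPsi_le_of_dim_le hdim
  have hfin : (Scheme.hsValues Y 3).Finite := Scheme.finite_hsValues_of_isExcellent hexc 3 hψ
  have husc : ∀ ν : ℕ → ℕ, IsClosed (Scheme.hsStratumGE Y 3 ν) :=
    (stub_isClosed_hsMaxLocus_over_field stub_hsFun_le_of_specializes_over_field k Y g
      inferInstance inferInstance 3 hdim).1
  have hsing : IsClosed (Scheme.regularLocus Y)ᶜ :=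
    (Scheme.isOpen_regularLocus_of_isQuasiExcellent hexc.isQuasiExcellent).isClosed_compl
  have hset : (Scheme.regularLocus Y)ᶜ \ Scheme.hsStratum Y 3 (hypersurfaceHF 2) =
      (Scheme.regularLocus Y)ᶜ ∩ {y : Y | Scheme.hsFun Y 3 y ≤ hypersurfaceHF 2}ᶜ := by
    ext y
    simp only [Set.mem_sdiff, Set.mem_compl_iff, Set.mem_inter_iff, Set.mem_setOf_eq,
      Scheme.mem_hsStratum_iff]
    constructor
    · rintro ⟨hreg, hne⟩
      exact ⟨hreg, fun hle => hne (hgap y hreg hle)⟩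
    · rintro ⟨hreg, hnle⟩
      exact ⟨hreg, fun heq => hnle heq.le⟩
  rw [hset]
  exact hsing.inter (isOpen_setOf_hsFun_le' husc hfin _).isClosed_compl

/-- **Given the quadric gap, the double-point stratum `Y(q)` is isolated from the rest of the singular
locus:** `closure (Sing Y ∖ Y(q))` is disjoint from `Y(q)`. [cite: CossartJannsenSaito2020, Rem. 6.29] -/
theorem disjoint_closure_of_quadricGap {k : Type} [Field k] {Y : Scheme.{0}}
    (g : Y ⟶ Spec (.of k)) [LocallyOfFiniteType g] [QuasiCompact g]
    (hdim : topologicalKrullDim Y ≤ ((3 : ℕ) : WithBot ℕ∞))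
    (hgap : ∀ y : Y, y ∉ Scheme.regularLocus Y → Scheme.hsFun Y 3 y ≤ hypersurfaceHF 2 →
      Scheme.hsFun Y 3 y = hypersurfaceHF 2) :
    Disjoint (closure ((Scheme.regularLocus Y)ᶜ \ Scheme.hsStratum Y 3 (hypersurfaceHF 2)))
      (Scheme.hsStratum Y 3 (hypersurfaceHF 2)) := by
  rw [(isClosed_compl_regularLocus_diff_hsStratum_of_quadricGap g hdim hgap).closure_eq]
  exact Set.disjoint_sdiff_left

/-- **The registered `stub_tameNu3` at `p = 3`, from the quadric gap** (vacuously: the only tame value is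
`q = hypersurfaceHF 2`, whose stratum is isolated by `disjoint_closure_of_quadricGap`, contradicting the
non-isolation hypothesis of the stub). [cite: CossartJannsenSaito2020, Rem. 6.29, Def. 6.14] -/
theorem tameNu3_three_of_quadricGap
    (hgap : ∀ (k : Type) [Field k] (Y : Scheme.{0}) (g : Y ⟶ Spec (.of k)), LocallyOfFiniteType g →
      QuasiCompact g → IsReduced Y → topologicalKrullDim Y ≤ ((3 : ℕ) : WithBot ℕ∞) →
      ∀ y : Y, y ∉ Scheme.regularLocus Y → Scheme.hsFun Y 3 y ≤ hypersurfaceHF 2 →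
        Scheme.hsFun Y 3 y = hypersurfaceHF 2) :
    ∀ (k : Type) [Field k] [CharP k 3] [PerfectField k] (Y : Scheme.{0})
      (g : Y ⟶ Spec (.of k)), IsSeparated g → LocallyOfFiniteType g → QuasiCompact g →
      IsReduced Y → ((3 : ℕ) : WithBot ℕ∞) ≤ topologicalKrullDim Y →
      topologicalKrullDim Y ≤ ((3 : ℕ) : WithBot ℕ∞) →
      ∀ ν : ℕ → ℕ, Maximal (· ∈ Scheme.hsValues Y 3) ν → ν ≠ iterPSum 3 Phi →
        IsTameValue 3 ν →
        ¬ Disjoint (closure ((Scheme.regularLocus Y)ᶜ \ Scheme.hsStratum Y 3 ν))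
            (Scheme.hsStratum Y 3 ν) →
        NuMod Y 3 3 ν := by
  intro k _ _ _ Y g _ hft hqc hred _ hdim ν hν hνΦ ht hndisj
  haveI : IsLocallyNoetherian Y := LocallyOfFiniteType.isLocallyNoetherian g
  obtain ⟨m, h2, hm3, rfl⟩ := two_le_of_isTameValue_of_mem_hsValues hν.prop hνΦ ht
  obtain rfl : m = 2 := by omega
  exact absurd (disjoint_closure_of_quadricGap g hdim (hgap k Y g hft hqc hred hdim)) hndisj

/-- **`stub_tameNu3` for every prime `p ≤ 3`, from the quadric gap** (`p = 2`: no tame value at all,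
`tameNu3_of_prime_le_two`; `p = 3`: the double-point stratum is isolated).
[cite: CossartJannsenSaito2020, Rem. 6.29] -/
theorem tameNu3_of_prime_le_three_of_quadricGap
    (hgap : ∀ (k : Type) [Field k] (Y : Scheme.{0}) (g : Y ⟶ Spec (.of k)), LocallyOfFiniteType g →
      QuasiCompact g → IsReduced Y → topologicalKrullDim Y ≤ ((3 : ℕ) : WithBot ℕ∞) →
      ∀ y : Y, y ∉ Scheme.regularLocus Y → Scheme.hsFun Y 3 y ≤ hypersurfaceHF 2 →
        Scheme.hsFun Y 3 y = hypersurfaceHF 2) :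
    ∀ p : ℕ, p.Prime → p ≤ 3 → ∀ (k : Type) [Field k] [CharP k p] [PerfectField k] (Y : Scheme.{0})
      (g : Y ⟶ Spec (.of k)), IsSeparated g → LocallyOfFiniteType g → QuasiCompact g →
      IsReduced Y → ((3 : ℕ) : WithBot ℕ∞) ≤ topologicalKrullDim Y →
      topologicalKrullDim Y ≤ ((3 : ℕ) : WithBot ℕ∞) →
      ∀ ν : ℕ → ℕ, Maximal (· ∈ Scheme.hsValues Y 3) ν → ν ≠ iterPSum 3 Phi →
        IsTameValue p ν →
        ¬ Disjoint (closure ((Scheme.regularLocus Y)ᶜ \ Scheme.hsStratum Y 3 ν))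
            (Scheme.hsStratum Y 3 ν) →
        NuMod Y 3 3 ν := by
  intro p _ hp3 k _ _ _ Y g _ hft hqc hred _ hdim ν hν hνΦ ht hndisj
  haveI : IsLocallyNoetherian Y := LocallyOfFiniteType.isLocallyNoetherian g
  obtain ⟨m, h2, hmp, rfl⟩ := two_le_of_isTameValue_of_mem_hsValues hν.prop hνΦ ht
  obtain rfl : m = 2 := by omega
  exact absurd (disjoint_closure_of_quadricGap g hdim (hgap k Y g hft hqc hred hdim)) hndisj

end Summit.ResolutionOfSingularities.ResolutionOfSingularities.Theorems.SigmaMaxModificationsCorridor3.TameWild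

end
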